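import Literature.Computability.Complexity.PRelHierarchy
import Literature.Computability.Complexity.OracleEmpty
import Literature.Computability.Complexity.BranchingFn
import Literature.Computability.Complexity.LengthCompare
import HarnessLib

/-!
# Rewriting the queries of an oracle algorithm by a polynomial-time map (transcript model)

Trunk `CplxCore`, companion of `OracleClosure.lean` (pre/post-processing of inputs and outputs)
and `OracleComposition.lean` / `OracleCompositionMachine.lean` (composition). Here the *queries* are rewritten: for an oracle algorithm `M` and a
string map `d`, the algorithm `M.mapQuery d` asks `d ⟨x, ⟨listBool as, q⟩⟩` whenever `M` would ask
`q` after the answers `as` on input `x` — so the rewriting may depend on the input, on the round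
(`|as|`) and on the whole transcript. This is the device by which a deterministic reduction is
run against a *randomised* (coin-taking) oracle: the `i`-th query `q` becomes `⟨⟨q, 1^k⟩, rᵢ⟩`
with the `i`-th block `rᵢ` of a random string `r` supplied in the input (Aaronson–Arkhipov 2013,
Thm. 1.1, p. 149: a randomised oracle is "a deterministic algorithm that takes a random string as
part of its input"; proof of Thm. 1.1, p. 178: fresh coins for each of the polynomially many
queries and a union bound).

* `OracleAlg.mapQuery`, `runAux_mapQuery` / `run_mapQuery`: if the rewritten queries are answered
  by `O` as the original ones are by `O₀` *along the run of `M` with `O₀`* (the free-running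
  transcript `PRelSigma.trans` of `PRelHierarchy.lean`, up to the output round), the runs
  coincide; `queriesAux_mapQuery`: the queries asked are the rewritten queries of that run;
* `OracleAlg.capQ`, `runAux_capQ` / `queriesAux_capQ`, `capQ_step_eq_inl`, `isPolyTime_capQ`:
  capping the query length at `c(|x|)` (abort with a default output on a longer query) — no
  effect on a run whose queries obey the cap, and the cap holds on *every* run, which is the
  query-length clause of `PRel`/`FPRel` for an algorithm run against a foreign oracle;
* `OracleAlg.isPolyTime_mapQuery`: `d ∈ FP ⟹ (M.mapQuery d)` is polynomial-time when `M` is —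
  assembled from `PolyTimeComputable.firstField` (`TM2Context.lean`), the pair/field transducers
  of `OracleClosure.lean`, and the branching combinator `iteFn` (`BranchingFn.lean`);
* `OracleAlg.comap`, `runAux_comap`, `isPolyTime_comap`: running on a pre-processed input;
* `OracleAlg.clock`, `run_clock_of_run`, `run_clock_isSome`, `isPolyTime_clock`: the clocked
  algorithm (output a default after `q(|x|)` rounds), which outputs against *every* oracle — the
  normal form needed when an algorithm designed for one oracle is run against another.

## References

* S. Arora, B. Barak, *Computational Complexity: A Modern Approach*, CUP 2009, §3.4 (oracle
  machines), §7.4 (randomised reductions; error reduction and union bounds).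
* S. Aaronson, A. Arkhipov, *The computational complexity of linear optics*, Theory of
  Computing 9 (2013), Thm. 1.1 (p. 149) and its proof (p. 178).
-/

namespace Literature.Computability.Complexity

open _root_.Computability PrePost EmptySim

namespace OracleAlg

variable {β : Type}

/-- **Rewriting the queries**: `M.mapQuery d` asks `d ⟨x, ⟨listBool as, q⟩⟩` when `M` asks `q`
after the answers `as` on input `x`; outputs are unchanged. [Aaronson–Arkhipov 2013, proof of Thm. 1.1 (p. 178)] [cite: AaronsonArkhipovToC2013, proof of Thm. 1.1 (p. 178)] [cite: AroraBarak2009, §3.4] -/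
def mapQuery (M : OracleAlg β) (d : List Bool → List Bool) : OracleAlg β where
  step x as :=
    match M.step x as with
    | Sum.inl q => Sum.inl (d (boolPair x (boolPair ((encodingList Bool).listBool.encode as) q)))
    | Sum.inr b => Sum.inr b

/-- The step of `M.mapQuery d` (definitional). [folklore] -/
theorem mapQuery_step (M : OracleAlg β) (d : List Bool → List Bool) (x : List Bool) (as : List (List Bool)) :
    (M.mapQuery d).step x as =
      match M.step x as with
      | Sum.inl q => Sum.inl (d (boolPair x (boolPair ((encodingList Bool).listBool.encode as) q)))
      | Sum.inr b => Sum.inr b :=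
  rfl

/-- `MapAgree M d O O₀ x`: along the run of `M` with `O₀` on `x` — at every round `i` all of whose
predecessors were queries — the oracle `O` answers the rewritten query as `O₀` answers the
original one. (Rounds past the output impose nothing.) [folklore] -/
def MapAgree (M : OracleAlg β) (d : List Bool → List Bool) (O O₀ : Oracle) (x : List Bool) : Prop :=
  ∀ (i : ℕ) (q : List Bool), (∀ i' < i, ∃ y, M.step x (PRelSigma.trans M O₀ x i') = Sum.inl y) →
    M.step x (PRelSigma.trans M O₀ x i) = Sum.inl q →
      O (d (boolPair x (boolPair ((encodingList Bool).listBool.encode (PRelSigma.trans M O₀ x i)) q))) = O₀ q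

/-- **Runs with rewritten queries**: under `MapAgree`, `M.mapQuery d` with `O` runs exactly as `M`
with `O₀`, from every round `j` of that run all of whose predecessors were queries. [Arora–Barak 2009, §3.4] [cite: AroraBarak2009, §3.4] -/
theorem runAux_mapQuery (M : OracleAlg β) (d : List Bool → List Bool) (O O₀ : Oracle) (x : List Bool)
    (hagree : MapAgree M d O O₀ x) :
    ∀ n j : ℕ, (∀ i' < j, ∃ y, M.step x (PRelSigma.trans M O₀ x i') = Sum.inl y) →
      (M.mapQuery d).runAux O x n (PRelSigma.trans M O₀ x j) = M.runAux O₀ x n (PRelSigma.trans M O₀ x j)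
  | 0, _, _ => rfl
  | n + 1, j, hj => by
    rw [runAux_succ, runAux_succ, mapQuery_step]
    cases hs : M.step x (PRelSigma.trans M O₀ x j) with
    | inr b => rfl
    | inl q =>
      dsimp only
      have htr : PRelSigma.trans M O₀ x j ++ [O₀ q] = PRelSigma.trans M O₀ x (j + 1) := by
        rw [PRelSigma.trans_succ, PRelSigma.qryOf_eq_of_step_eq hs]
      rw [hagree j q hj hs, htr]
      refine runAux_mapQuery M d O O₀ x hagree n (j + 1) fun i' hi' => ?_
      rcases Nat.lt_succ_iff_lt_or_eq.1 hi' with h | rfl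
      · exact hj i' h
      · exact ⟨q, hs⟩

/-- **Runs with rewritten queries, from the start.** [Arora–Barak 2009, §3.4] [cite: AroraBarak2009, §3.4] -/
theorem run_mapQuery (M : OracleAlg β) (d : List Bool → List Bool) (O O₀ : Oracle) (x : List Bool)
    (hagree : MapAgree M d O O₀ x) (n : ℕ) : (M.mapQuery d).run O n x = M.run O₀ n x :=
  runAux_mapQuery M d O O₀ x hagree n 0 (fun _ h => absurd h (Nat.not_lt_zero _))

/-- **Queries with rewritten queries**: under `MapAgree`, the queries of `M.mapQuery d` with `O`
from round `j` are rewritten queries of `M` with `O₀`: each is `d ⟨x, ⟨listBool as, q⟩⟩` for the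
transcript `as` of a round all of whose predecessors were queries and the query `q` of that
round. [Arora–Barak 2009, §3.4] [cite: AroraBarak2009, §3.4] -/
theorem queriesAux_mapQuery (M : OracleAlg β) (d : List Bool → List Bool) (O O₀ : Oracle) (x : List Bool)
    (hagree : MapAgree M d O O₀ x) :
    ∀ (n j : ℕ) (z : List Bool), (∀ i' < j, ∃ y, M.step x (PRelSigma.trans M O₀ x i') = Sum.inl y) →
      z ∈ (M.mapQuery d).queriesAux O x n (PRelSigma.trans M O₀ x j) →
      ∃ i q, (∀ i' < i, ∃ y, M.step x (PRelSigma.trans M O₀ x i') = Sum.inl y) ∧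
        M.step x (PRelSigma.trans M O₀ x i) = Sum.inl q ∧
        q ∈ M.queriesAux O₀ x n (PRelSigma.trans M O₀ x j) ∧
        z = d (boolPair x (boolPair ((encodingList Bool).listBool.encode (PRelSigma.trans M O₀ x i)) q))
  | 0, _, z, _, hz => by simp at hz
  | n + 1, j, z, hj, hz => by
    unfold queriesAux at hz ⊢
    rw [mapQuery_step] at hz
    cases hs : M.step x (PRelSigma.trans M O₀ x j) with
    | inr b => rw [hs] at hz; simp at hz
    | inl q =>
      rw [hs] at hz
      dsimp only at hz ⊢
      have htr : PRelSigma.trans M O₀ x j ++ [O₀ q] = PRelSigma.trans M O₀ x (j + 1) := by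
        rw [PRelSigma.trans_succ, PRelSigma.qryOf_eq_of_step_eq hs]
      have hj' : ∀ i' < j + 1, ∃ y, M.step x (PRelSigma.trans M O₀ x i') = Sum.inl y := fun i' hi' => by
        rcases Nat.lt_succ_iff_lt_or_eq.1 hi' with h | rfl
        · exact hj i' h
        · exact ⟨q, hs⟩
      rcases List.mem_cons.1 hz with rfl | hz'
      · exact ⟨j, q, hj, hs, List.mem_cons_self, rfl⟩
      · rw [hagree j q hj hs, htr] at hz'
        obtain ⟨i, q', hi, hsi, hq', rfl⟩ := queriesAux_mapQuery M d O O₀ x hagree n (j + 1) z hj' hz'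
        refine ⟨i, q', hi, hsi, ?_, rfl⟩
        rw [htr]
        exact List.mem_cons_of_mem _ hq'

/-- **Queries with rewritten queries, from the start.** [Arora–Barak 2009, §3.4] [cite: AroraBarak2009, §3.4] -/
theorem queries_mapQuery (M : OracleAlg β) (d : List Bool → List Bool) (O O₀ : Oracle) (x : List Bool)
    (hagree : MapAgree M d O O₀ x) (n : ℕ) {z : List Bool} (hz : z ∈ (M.mapQuery d).queries O n x) :
    ∃ i q, (∀ i' < i, ∃ y, M.step x (PRelSigma.trans M O₀ x i') = Sum.inl y) ∧
      M.step x (PRelSigma.trans M O₀ x i) = Sum.inl q ∧ q ∈ M.queries O₀ n x ∧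
      z = d (boolPair x (boolPair ((encodingList Bool).listBool.encode (PRelSigma.trans M O₀ x i)) q)) :=
  queriesAux_mapQuery M d O O₀ x hagree n 0 z (fun _ h => absurd h (Nat.not_lt_zero _)) hz


/-! ### Capping the query length -/

section Cap

/-- **Capping the queries**: `M.capQ c b₀` behaves as `M` but, when `M` would ask a query longer
than `c(|x|)`, outputs the default `b₀` instead — so every query it asks, in every transcript,
has length `≤ c(|x|)` (`capQ_step_eq_inl`), and it agrees with `M` on every run whose queries
obey the cap (`runAux_capQ`). (The query-length clause of `PRel`/`FPRel`, `Oracle.lean`,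
enforced by construction.) [cite: AroraBarak2009, §3.4] -/
def capQ (M : OracleAlg β) (c : Polynomial ℕ) (b₀ : β) : OracleAlg β where
  step x as := match M.step x as with
    | Sum.inl y => if y.length ≤ c.eval x.length then Sum.inl y else Sum.inr b₀
    | Sum.inr b => Sum.inr b

/-- The step of `M.capQ c b₀` (definitional). [folklore] -/
theorem capQ_step (M : OracleAlg β) (c : Polynomial ℕ) (b₀ : β) (x : List Bool) (as : List (List Bool)) :
    (M.capQ c b₀).step x as = (match M.step x as with
      | Sum.inl y => if y.length ≤ c.eval x.length then Sum.inl y else Sum.inr b₀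
      | Sum.inr b => Sum.inr b) :=
  rfl

/-- **Every query of the capped algorithm obeys the cap.** [folklore] -/
theorem capQ_step_eq_inl {M : OracleAlg β} {c : Polynomial ℕ} {b₀ : β} {x : List Bool} {as : List (List Bool)}
    {y : List Bool} (h : (M.capQ c b₀).step x as = Sum.inl y) : y.length ≤ c.eval x.length := by
  rw [capQ_step] at h
  cases hs : M.step x as with
  | inr b => rw [hs] at h; cases h
  | inl y' =>
    rw [hs] at h
    dsimp only at h
    split_ifs at h with hc
    cases h
    exact hc

/-- Hence every query in every transcript of the capped algorithm obeys the cap. [folklore] -/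
theorem length_le_of_mem_queriesAux_capQ (M : OracleAlg β) (c : Polynomial ℕ) (b₀ : β) (O : Oracle) (x : List Bool) :
    ∀ (n : ℕ) (as : List (List Bool)) (y : List Bool), y ∈ (M.capQ c b₀).queriesAux O x n as →
      y.length ≤ c.eval x.length
  | 0, _, _, h => by simp at h
  | n + 1, as, y, h => by
    unfold queriesAux at h
    cases hs : (M.capQ c b₀).step x as with
    | inr b => rw [hs] at h; simp at h
    | inl y' =>
      rw [hs] at h
      rcases List.mem_cons.1 h with rfl | h
      · exact capQ_step_eq_inl hs
      · exact length_le_of_mem_queriesAux_capQ M c b₀ O x n _ y h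

/-- Every query of `(M.capQ c b₀).queries O n x` obeys the cap. [folklore] -/
theorem length_le_of_mem_queries_capQ (M : OracleAlg β) (c : Polynomial ℕ) (b₀ : β) (O : Oracle) (x : List Bool)
    (n : ℕ) {y : List Bool} (h : y ∈ (M.capQ c b₀).queries O n x) : y.length ≤ c.eval x.length :=
  length_le_of_mem_queriesAux_capQ M c b₀ O x n [] y h

/-- **The cap does not act on a run whose queries obey it**: same run. [folklore] -/
theorem runAux_capQ (M : OracleAlg β) (c : Polynomial ℕ) (b₀ : β) (O : Oracle) (x : List Bool) :
    ∀ (n : ℕ) (as : List (List Bool)), (∀ y ∈ M.queriesAux O x n as, y.length ≤ c.eval x.length) →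
      (M.capQ c b₀).runAux O x n as = M.runAux O x n as
  | 0, _, _ => rfl
  | n + 1, as, h => by
    rw [runAux_succ, runAux_succ, capQ_step]
    unfold queriesAux at h
    cases hs : M.step x as with
    | inr b => rfl
    | inl y =>
      rw [hs] at h
      dsimp only at h ⊢
      rw [if_pos (h y List.mem_cons_self)]
      exact runAux_capQ M c b₀ O x n _ fun y' hy' => h y' (List.mem_cons_of_mem _ hy')

/-- … and the same transcript of queries. [folklore] -/
theorem queriesAux_capQ (M : OracleAlg β) (c : Polynomial ℕ) (b₀ : β) (O : Oracle) (x : List Bool) :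
    ∀ (n : ℕ) (as : List (List Bool)), (∀ y ∈ M.queriesAux O x n as, y.length ≤ c.eval x.length) →
      (M.capQ c b₀).queriesAux O x n as = M.queriesAux O x n as
  | 0, _, _ => rfl
  | n + 1, as, h => by
    have h' := h
    unfold queriesAux at h' ⊢
    rw [capQ_step]
    cases hs : M.step x as with
    | inr b => rfl
    | inl y =>
      rw [hs] at h'
      dsimp only at h' ⊢
      rw [if_pos (h' y List.mem_cons_self)]
      exact congrArg (List.cons y) (queriesAux_capQ M c b₀ O x n _ fun y' hy' => h' y' (List.mem_cons_of_mem _ hy'))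

/-- **The capped algorithm from the start**: if every query of `M.queries O n x` obeys the cap,
`(M.capQ c b₀).run O n x = M.run O n x` and the queries coincide. [folklore] -/
theorem run_capQ (M : OracleAlg β) (c : Polynomial ℕ) (b₀ : β) (O : Oracle) (x : List Bool) (n : ℕ)
    (h : ∀ y ∈ M.queries O n x, y.length ≤ c.eval x.length) :
    (M.capQ c b₀).run O n x = M.run O n x ∧ (M.capQ c b₀).queries O n x = M.queries O n x :=
  ⟨runAux_capQ M c b₀ O x n [] h, queriesAux_capQ M c b₀ O x n [] h⟩

end Cap

/-! ### Clocking an oracle algorithm -/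

section Clock

/-- **The clocked algorithm**: `M.clock q b₀` behaves as `M` for `q(|x|)` rounds and then outputs
the default `b₀` — so it produces an output within `q(|x|) + 1` rounds against *every* oracle
(`run_clock_isSome`), and agrees with `M` whenever `M` outputs within `q(|x|)` rounds
(`run_clock_of_run`). (Arora–Barak 2009, §3.4 with §1.4.1: time bounds of oracle machines are
enforced by a clock, independently of the oracle.) [cite: AroraBarak2009, §3.4] -/
def clock (M : OracleAlg β) (q : Polynomial ℕ) (b₀ : β) : OracleAlg β where
  step x as := if as.length < q.eval x.length then M.step x as else Sum.inr b₀

/-- The step of `M.clock q b₀` (definitional). [folklore] -/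
theorem clock_step (M : OracleAlg β) (q : Polynomial ℕ) (b₀ : β) (x : List Bool) (as : List (List Bool)) :
    (M.clock q b₀).step x as = if as.length < q.eval x.length then M.step x as else Sum.inr b₀ :=
  rfl

/-- Along a transcript growing by one answer per round, the clocked algorithm runs as `M` while
the clock allows, and outputs within the remaining budget. [folklore] -/
theorem runAux_clock (M : OracleAlg β) (q : Polynomial ℕ) (b₀ : β) (O : Oracle) (x : List Bool) :
    ∀ (n : ℕ) (as : List (List Bool)), as.length + n ≤ q.eval x.length →
      (M.clock q b₀).runAux O x n as = M.runAux O x n as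
  | 0, _, _ => rfl
  | n + 1, as, h => by
    rw [runAux_succ, runAux_succ, clock_step, if_pos (by omega)]
    cases M.step x as with
    | inr b => rfl
    | inl y => exact runAux_clock M q b₀ O x n _ (by simp; omega)

/-- **The clocked algorithm agrees with `M`** when `M` outputs within the clock. [Arora–Barak 2009, §3.4] [cite: AroraBarak2009, §3.4] -/
theorem run_clock_of_run (M : OracleAlg β) (q : Polynomial ℕ) (b₀ : β) (O : Oracle) (x : List Bool)
    {b : β} (h : M.run O (q.eval x.length) x = some b) {n : ℕ} (hn : q.eval x.length ≤ n) :
    (M.clock q b₀).run O n x = some b := by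
  apply run_mono _ O x hn
  change (M.clock q b₀).runAux O x _ [] = _
  rw [runAux_clock M q b₀ O x _ [] (by simp)]
  exact h

/-- **The clocked algorithm always outputs within `q(|x|) + 1` rounds**, against every oracle and
from every transcript. [Arora–Barak 2009, §3.4 with §1.4.1] [cite: AroraBarak2009, §3.4] -/
theorem runAux_clock_isSome (M : OracleAlg β) (q : Polynomial ℕ) (b₀ : β) (O : Oracle) (x : List Bool) :
    ∀ (n : ℕ) (as : List (List Bool)), q.eval x.length ≤ as.length + n →
      ((M.clock q b₀).runAux O x (n + 1) as).isSome
  | 0, as, h => by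
    rw [runAux_succ, clock_step, if_neg (by omega)]
    rfl
  | n + 1, as, h => by
    rw [runAux_succ, clock_step]
    by_cases hc : as.length < q.eval x.length
    · rw [if_pos hc]
      cases M.step x as with
      | inr b => rfl
      | inl y => exact runAux_clock_isSome M q b₀ O x n _ (by simp; omega)
    · rw [if_neg hc]; rfl

/-- Hence `(M.clock q b₀).run O n x` is an output for every `n > q(|x|)`. [Arora–Barak 2009, §3.4] [cite: AroraBarak2009, §3.4] -/
theorem run_clock_isSome (M : OracleAlg β) (q : Polynomial ℕ) (b₀ : β) (O : Oracle) (x : List Bool) {n : ℕ}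
    (hn : q.eval x.length < n) : ((M.clock q b₀).run O n x).isSome := by
  obtain ⟨n, rfl⟩ := Nat.exists_eq_add_of_lt hn
  rw [show q.eval x.length + n + 1 = (q.eval x.length + n) + 1 by omega]
  exact runAux_clock_isSome M q b₀ O x _ [] (by simp)

/-- The queries of the clocked algorithm are among those of `M` (same fuel, same transcript):
while the clock runs the two agree, afterwards the clocked algorithm asks nothing. [folklore] -/
theorem queriesAux_clock_subset (M : OracleAlg β) (q : Polynomial ℕ) (b₀ : β) (O : Oracle) (x : List Bool) :
    ∀ (n : ℕ) (as : List (List Bool)) (y : List Bool),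
      y ∈ (M.clock q b₀).queriesAux O x n as → y ∈ M.queriesAux O x n as
  | 0, _, _, h => by simp at h
  | n + 1, as, y, h => by
    unfold queriesAux at h ⊢
    rw [clock_step] at h
    by_cases hc : as.length < q.eval x.length
    · rw [if_pos hc] at h
      cases hs : M.step x as with
      | inr b => rw [hs] at h; simp at h
      | inl y' =>
        rw [hs] at h
        dsimp only at h ⊢
        rcases List.mem_cons.1 h with rfl | h
        · exact List.mem_cons_self
        · exact List.mem_cons_of_mem _ (queriesAux_clock_subset M q b₀ O x n _ y h)
    · rw [if_neg hc] at h
      simp at h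

/-- Hence every query of `(M.clock q b₀).queries O n x` is a query of `M.queries O n x`. [folklore] -/
theorem queries_clock_subset (M : OracleAlg β) (q : Polynomial ℕ) (b₀ : β) (O : Oracle) (x : List Bool) (n : ℕ)
    {y : List Bool} (h : y ∈ (M.clock q b₀).queries O n x) : y ∈ M.queries O n x :=
  queriesAux_clock_subset M q b₀ O x n [] y h

end Clock

/-! ### Reading the input through a map -/

section Comap

/-- **Pre-processing the input**: `M.comap pre` runs `M` on `pre w` (queries and outputs
unchanged; the transcript is shared). Companion of `OracleAlg.prePost` of `OracleClosure.lean`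
for arbitrary output types. [Arora–Barak 2009, §3.4 Example 3.6 (2)] [cite: AroraBarak2009, §3.4 Example 3.6 (2) with Remark 3.8] -/
def comap (M : OracleAlg β) (pre : List Bool → List Bool) : OracleAlg β where
  step w as := M.step (pre w) as

/-- The step of `M.comap pre` (definitional). [folklore] -/
@[simp] theorem comap_step (M : OracleAlg β) (pre : List Bool → List Bool) (w : List Bool) (as : List (List Bool)) :
    (M.comap pre).step w as = M.step (pre w) as :=
  rfl

/-- Runs of `M.comap pre` on `w` are the runs of `M` on `pre w`. [folklore] -/
theorem runAux_comap (M : OracleAlg β) (pre : List Bool → List Bool) (O : Oracle) (w : List Bool) :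
    ∀ (n : ℕ) (as : List (List Bool)), (M.comap pre).runAux O w n as = M.runAux O (pre w) n as
  | 0, _ => rfl
  | n + 1, as => by
    rw [runAux_succ, runAux_succ, comap_step]
    cases M.step (pre w) as with
    | inl y => exact runAux_comap M pre O w n _
    | inr b => rfl

/-- Transcripts of `M.comap pre` on `w` are those of `M` on `pre w`. [folklore] -/
theorem queriesAux_comap (M : OracleAlg β) (pre : List Bool → List Bool) (O : Oracle) (w : List Bool) :
    ∀ (n : ℕ) (as : List (List Bool)), (M.comap pre).queriesAux O w n as = M.queriesAux O (pre w) n as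
  | 0, _ => rfl
  | n + 1, as => by
    unfold queriesAux
    rw [comap_step]
    cases M.step (pre w) as with
    | inl y => exact congrArg (List.cons y) (queriesAux_comap M pre O w n _)
    | inr b => rfl

end Comap

/-! ### Polynomial time -/

section PolyTime

variable (eb : Encoding β Bool)

namespace QueryMapPoly

/-- Field encoding of (step result, step arguments as context). [folklore] -/
def encQ (q : (List Bool ⊕ β) × (List Bool × List (List Bool))) : List (Option Bool) :=
  (((encodingList Bool).sumBool eb).encode q.1).map some ++ none :: (encIn q.2).map some

/-- **Stage B is polynomial-time**: the step function on the front field, the duplicated step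
arguments carried behind the separator (`PolyTimeComputable.firstField`; the `β`-general form of
`EmptySim.polyTime_stageB`). [Arora–Barak 2009, §3.4 with Claim 1.6] [cite: AroraBarak2009, §3.4] -/
theorem polyTime_stB {M : OracleAlg β} (hM : M.IsPolyTime eb) :
    PolyTimeComputable encA (encQ eb) (Prod.map (Function.uncurry M.step) id) :=
  PolyTimeComputable.firstField (fun p : St => (encIn p).map some) hM

/-- Stage C (typed): rewrite a query with `d ⟨x, ⟨listBool as, q⟩⟩`, keep an output. [folklore] -/
def stC (d : List Bool → List Bool) (q : (List Bool ⊕ β) × (List Bool × List (List Bool))) : List Bool ⊕ β :=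
  match q.1 with
  | Sum.inl y => Sum.inl (d (boolPair q.2.1 (boolPair ((encodingList Bool).listBool.encode q.2.2) y)))
  | Sum.inr b => Sum.inr b

/-- The step of `M.mapQuery d` factors through the stages. [folklore] -/
theorem uncurry_mapQuery_step (M : OracleAlg β) (d : List Bool → List Bool) :
    Function.uncurry (M.mapQuery d).step = stC d ∘ Prod.map (Function.uncurry M.step) id ∘ fun p : St => (p, p) := by
  funext p
  obtain ⟨x, as⟩ := p
  simp only [Function.uncurry_apply_pair, Function.comp_apply, stC, Prod.map_apply, id, mapQuery_step]

/-- Stage C as a string map: `fromField`, then on `⟨tag :: payload, ⟨x, LB as⟩⟩` output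
`0 (d ⟨x, ⟨LB as, payload⟩⟩)` if the tag is `0` (a query), the step result unchanged otherwise. [folklore] -/
noncomputable def GC (d : List Bool → List Bool) : List (Option Bool) → List Bool :=
  iteFn (headT.eval ∘ fun z => (boolUnpair z).1) (fun z => (boolUnpair z).1)
    (List.cons false ∘ d ∘ fanoutFn (fun z => (boolUnpair (boolUnpair z).2).1)
      (fanoutFn (fun z => (boolUnpair (boolUnpair z).2).2) (tailT.eval ∘ fun z => (boolUnpair z).1))) ∘
  fromField.eval

/-- **Stage C is polynomial-time** for `d ∈ FP`. [Arora–Barak 2009, §1.3] [cite: AroraBarak2009, §1.3] -/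
theorem polyTime_stC {d : List Bool → List Bool} (hd : d ∈ FP) :
    PolyTimeComputable (encQ eb) ((encodingList Bool).sumBool eb).encode (stC (β := β) d) := by
  have hfst : (fun z : List Bool => (boolUnpair z).1) ∈ FP := boolUnpairFst_mem_FP
  have hsnd : (fun z : List Bool => (boolUnpair z).2) ∈ FP := boolUnpairSnd_mem_FP
  have hW : (iteFn (headT.eval ∘ fun z => (boolUnpair z).1) (fun z => (boolUnpair z).1)
      (List.cons false ∘ d ∘ fanoutFn (fun z => (boolUnpair (boolUnpair z).2).1)
        (fanoutFn (fun z => (boolUnpair (boolUnpair z).2).2) (tailT.eval ∘ fun z => (boolUnpair z).1)))) ∈ FP :=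
    iteFn_mem_FP (comp_mem_FP headT.polyTimeComputable_eval hfst) hfst
      (comp_mem_FP (cons_mem_FP false) (comp_mem_FP hd (fanoutFn_mem_FP (comp_mem_FP hfst hsnd)
        (fanoutFn_mem_FP (comp_mem_FP hsnd hsnd) (comp_mem_FP tailT.polyTimeComputable_eval hfst)))))
  have hS : PolyTimeComputable (id : List (Option Bool) → _) (id : List Bool → List Bool) (GC d) :=
    PolyTimeComputable.comp_holds hW fromField.polyTimeComputable_eval
  refine PolyTimeComputable.of_encode hS (encQ eb) (fun _ => rfl) fun q => ?_
  obtain ⟨r, x, as⟩ := q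
  have hin : encIn (x, as) = boolPair x ((encodingList Bool).listBool.encode as) := rfl
  simp only [id, GC, Function.comp_apply, encQ, fromField_eval, hin]
  have hid : ∀ w : List Bool, (encodingList Bool).encode w = w := fun _ => rfl
  cases r with
  | inl y =>
    rw [iteFn_apply_false]
    · simp [stC, tailT_eval_cons, Encoding.sumBool, hid]
    · simp [headT_eval_cons, Encoding.sumBool, hid]
  | inr b =>
    rw [iteFn_apply_true]
    · simp [stC, Encoding.sumBool]
    · simp [headT_eval_cons, Encoding.sumBool]


/-- Stage C of the clock (typed): keep the step result while `|as| < q(|x|)`, else output `b₀`. [folklore] -/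
def stClk (q : Polynomial ℕ) (b₀ : β) (r : (List Bool ⊕ β) × (List Bool × List (List Bool))) : List Bool ⊕ β :=
  if r.2.2.length < q.eval r.2.1.length then r.1 else Sum.inr b₀

/-- The step of `M.clock q b₀` factors through the stages. [folklore] -/
theorem uncurry_clock_step (M : OracleAlg β) (q : Polynomial ℕ) (b₀ : β) :
    Function.uncurry (M.clock q b₀).step = stClk q b₀ ∘ Prod.map (Function.uncurry M.step) id ∘ fun p : St => (p, p) := by
  funext p
  obtain ⟨x, as⟩ := p
  simp only [Function.uncurry_apply_pair, Function.comp_apply, stClk, Prod.map_apply, id, clock_step]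

/-- `[|as| < q(|x|)]` on `⟨x, LB as⟩`: the unary length field of `LB as` with one more `1` is at
most `q(|x|)` long (`lenLeFn`). [folklore] -/
noncomputable def cClk (q : Polynomial ℕ) : List Bool → List Bool :=
  lenLeFn q ∘ fanoutFn (fun z => (boolUnpair z).1) (List.cons true ∘ (fun z => (boolUnpair z).1) ∘ fun z => (boolUnpair z).2)

/-- The value of `cClk` on a step input. [folklore] -/
theorem cClk_apply (q : Polynomial ℕ) (x : List Bool) (as : List (List Bool)) :
    cClk q (boolPair x ((encodingList Bool).listBool.encode as)) = [decide (as.length < q.eval x.length)] := by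
  have hun : ∀ n : ℕ, (unaryEncodeNat n).length = n := by
    intro n; induction n with
    | zero => rfl
    | succ n ih => simp [unaryEncodeNat, ih]
  simp only [cClk, Function.comp_apply, fanoutFn_apply, boolUnpair_boolPair, Encoding.listBool, lenLeFn_boolPair,
    List.length_cons, hun]
  congr 1

/-- `cClk q` is in `FP`. [folklore] -/
theorem cClk_mem_FP (q : Polynomial ℕ) : cClk q ∈ FP :=
  comp_mem_FP (lenLeFn_mem_FP q) (fanoutFn_mem_FP boolUnpairFst_mem_FP
    (comp_mem_FP (cons_mem_FP true) (comp_mem_FP boolUnpairFst_mem_FP boolUnpairSnd_mem_FP)))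

/-- Stage C of the clock as a string map. [folklore] -/
noncomputable def GClk (q : Polynomial ℕ) (b₀ : β) : List (Option Bool) → List Bool :=
  iteFn (cClk q ∘ fun z => (boolUnpair z).2) (fun z => (boolUnpair z).1)
    (fun _ => ((encodingList Bool).sumBool eb).encode (Sum.inr b₀)) ∘ fromField.eval

/-- **Stage C of the clock is polynomial-time.** [folklore] -/
theorem polyTime_stClk (q : Polynomial ℕ) (b₀ : β) :
    PolyTimeComputable (encQ eb) ((encodingList Bool).sumBool eb).encode (stClk q b₀) := by
  have hW : (iteFn (cClk q ∘ fun z => (boolUnpair z).2) (fun z => (boolUnpair z).1)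
      (fun _ => ((encodingList Bool).sumBool eb).encode (Sum.inr b₀))) ∈ FP :=
    iteFn_mem_FP (comp_mem_FP (cClk_mem_FP q) boolUnpairSnd_mem_FP) boolUnpairFst_mem_FP (const_mem_FP _)
  have hS : PolyTimeComputable (id : List (Option Bool) → _) (id : List Bool → List Bool) (GClk eb q b₀) :=
    PolyTimeComputable.comp_holds hW fromField.polyTimeComputable_eval
  refine PolyTimeComputable.of_encode hS (encQ eb) (fun _ => rfl) fun r => ?_
  obtain ⟨r, x, as⟩ := r
  have hin : encIn (x, as) = boolPair x ((encodingList Bool).listBool.encode as) := rfl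
  simp only [id, GClk, Function.comp_apply, encQ, fromField_eval, hin, stClk]
  by_cases hc : as.length < q.eval x.length
  · rw [iteFn_apply_true (by rw [Function.comp_apply, boolUnpair_boolPair, cClk_apply]; simp [hc]), if_pos hc,
      boolUnpair_boolPair]
  · rw [iteFn_apply_false (by rw [Function.comp_apply, boolUnpair_boolPair, cClk_apply]; simp [hc]), if_neg hc]

/-- Stage C of the cap (typed): a query longer than `c(|x|)` becomes the output `b₀`. [folklore] -/
def stCap (c : Polynomial ℕ) (b₀ : β) (r : (List Bool ⊕ β) × (List Bool × List (List Bool))) : List Bool ⊕ β :=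
  match r.1 with
  | Sum.inl y => if y.length ≤ c.eval r.2.1.length then Sum.inl y else Sum.inr b₀
  | Sum.inr b => Sum.inr b

/-- The step of `M.capQ c b₀` factors through the stages. [folklore] -/
theorem uncurry_capQ_step (M : OracleAlg β) (c : Polynomial ℕ) (b₀ : β) :
    Function.uncurry (M.capQ c b₀).step = stCap c b₀ ∘ Prod.map (Function.uncurry M.step) id ∘ fun p : St => (p, p) := by
  funext p
  obtain ⟨x, as⟩ := p
  simp only [Function.uncurry_apply_pair, Function.comp_apply, stCap, Prod.map_apply, id, capQ_step]
  cases M.step x as <;> rfl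

/-- `[|y| ≤ c(|x|)]` on `⟨tag :: y, ⟨x, LB as⟩⟩` (`lenLeFn`). [folklore] -/
noncomputable def cCap (c : Polynomial ℕ) : List Bool → List Bool :=
  lenLeFn c ∘ fanoutFn (fun z => (boolUnpair (boolUnpair z).2).1) (tailT.eval ∘ fun z => (boolUnpair z).1)

/-- The value of `cCap` on a step context. [folklore] -/
theorem cCap_apply (c : Polynomial ℕ) (tag : Bool) (y x v : List Bool) :
    cCap c (boolPair (tag :: y) (boolPair x v)) = [decide (y.length ≤ c.eval x.length)] := by
  simp only [cCap, Function.comp_apply, fanoutFn_apply, boolUnpair_boolPair, tailT_eval_cons, lenLeFn_boolPair]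

/-- `cCap c` is in `FP`. [folklore] -/
theorem cCap_mem_FP (c : Polynomial ℕ) : cCap c ∈ FP :=
  comp_mem_FP (lenLeFn_mem_FP c) (fanoutFn_mem_FP (comp_mem_FP boolUnpairFst_mem_FP boolUnpairSnd_mem_FP)
    (comp_mem_FP tailT.polyTimeComputable_eval boolUnpairFst_mem_FP))

/-- Stage C of the cap as a string map. [folklore] -/
noncomputable def GCap (c : Polynomial ℕ) (b₀ : β) : List (Option Bool) → List Bool :=
  iteFn (headT.eval ∘ fun z => (boolUnpair z).1) (fun z => (boolUnpair z).1)
    (iteFn (cCap c) (fun z => (boolUnpair z).1) (fun _ => ((encodingList Bool).sumBool eb).encode (Sum.inr b₀))) ∘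
  fromField.eval

/-- **Stage C of the cap is polynomial-time.** [folklore] -/
theorem polyTime_stCap (c : Polynomial ℕ) (b₀ : β) :
    PolyTimeComputable (encQ eb) ((encodingList Bool).sumBool eb).encode (stCap c b₀) := by
  have hfst : (fun z : List Bool => (boolUnpair z).1) ∈ FP := boolUnpairFst_mem_FP
  have hW : (iteFn (headT.eval ∘ fun z => (boolUnpair z).1) (fun z => (boolUnpair z).1)
      (iteFn (cCap c) (fun z => (boolUnpair z).1) (fun _ => ((encodingList Bool).sumBool eb).encode (Sum.inr b₀)))) ∈ FP :=
    iteFn_mem_FP (comp_mem_FP headT.polyTimeComputable_eval hfst) hfst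
      (iteFn_mem_FP (cCap_mem_FP c) hfst (const_mem_FP _))
  have hS : PolyTimeComputable (id : List (Option Bool) → _) (id : List Bool → List Bool) (GCap eb c b₀) :=
    PolyTimeComputable.comp_holds hW fromField.polyTimeComputable_eval
  refine PolyTimeComputable.of_encode hS (encQ eb) (fun _ => rfl) fun r => ?_
  obtain ⟨r, x, as⟩ := r
  have hin : encIn (x, as) = boolPair x ((encodingList Bool).listBool.encode as) := rfl
  simp only [id, GCap, Function.comp_apply, encQ, fromField_eval, hin]
  have hid : ∀ w : List Bool, (encodingList Bool).encode w = w := fun _ => rfl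
  cases r with
  | inl y =>
    have htag : (((encodingList Bool).sumBool eb).encode (Sum.inl y)) = false :: y := by
      simp [Encoding.sumBool, hid]
    rw [htag, iteFn_apply_false (by simp [headT_eval_cons])]
    by_cases hc : y.length ≤ c.eval x.length
    · rw [iteFn_apply_true (by rw [cCap_apply]; simp [hc]), boolUnpair_boolPair]
      simp [stCap, hc, Encoding.sumBool, hid]
    · rw [iteFn_apply_false (by rw [cCap_apply]; simp [hc])]
      simp [stCap, hc]
  | inr b =>
    rw [iteFn_apply_true (by simp [headT_eval_cons, Encoding.sumBool]), boolUnpair_boolPair]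
    simp [stCap]

end QueryMapPoly

open QueryMapPoly

/-- **`M.mapQuery d` is polynomial-time** for `M` polynomial-time and `d ∈ FP`. [Arora–Barak 2009, §3.4 with §1.3] [cite: AroraBarak2009, §3.4] -/
theorem isPolyTime_mapQuery {M : OracleAlg β} {d : List Bool → List Bool} (hM : M.IsPolyTime eb) (hd : d ∈ FP) :
    (M.mapQuery d).IsPolyTime eb := by
  unfold IsPolyTime
  rw [uncurry_mapQuery_step]
  exact PolyTimeComputable.comp_holds (polyTime_stC eb hd) (PolyTimeComputable.comp_holds (polyTime_stB eb hM) polyTime_stageA)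

/-- **`M.clock q b₀` is polynomial-time** when `M` is. [Arora–Barak 2009, §3.4 with §1.4.1] [cite: AroraBarak2009, §3.4] -/
theorem isPolyTime_clock {M : OracleAlg β} (hM : M.IsPolyTime eb) (q : Polynomial ℕ) (b₀ : β) :
    (M.clock q b₀).IsPolyTime eb := by
  unfold IsPolyTime
  rw [uncurry_clock_step]
  exact PolyTimeComputable.comp_holds (polyTime_stClk eb q b₀) (PolyTimeComputable.comp_holds (polyTime_stB eb hM) polyTime_stageA)

/-- **`M.capQ c b₀` is polynomial-time** when `M` is. [Arora–Barak 2009, §3.4 with §1.3] [cite: AroraBarak2009, §3.4] -/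
theorem isPolyTime_capQ {M : OracleAlg β} (hM : M.IsPolyTime eb) (c : Polynomial ℕ) (b₀ : β) :
    (M.capQ c b₀).IsPolyTime eb := by
  unfold IsPolyTime
  rw [uncurry_capQ_step]
  exact PolyTimeComputable.comp_holds (polyTime_stCap eb c b₀) (PolyTimeComputable.comp_holds (polyTime_stB eb hM) polyTime_stageA)

/-- **`M.comap pre` is polynomial-time** for `M` polynomial-time and `pre ∈ FP`: the step input
`⟨w, listBool as⟩ ↦ ⟨pre w, listBool as⟩` is `mapFstFn pre`. [Arora–Barak 2009, §3.4 with Thm. 2.8 (proof)] [cite: AroraBarak2009, §3.4] -/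
theorem isPolyTime_comap {M : OracleAlg β} (hM : M.IsPolyTime eb) {pre : List Bool → List Bool} (hpre : pre ∈ FP) :
    (M.comap pre).IsPolyTime eb := by
  have hin : PolyTimeComputable encIn encIn (fun p : List Bool × List (List Bool) => (pre p.1, p.2)) := by
    refine PolyTimeComputable.of_encode (mapFstFn_mem_FP hpre) encIn (fun _ => rfl) fun p => ?_
    obtain ⟨w, as⟩ := p
    show mapFstFn pre (boolPair w _) = boolPair (pre w) _
    rw [mapFstFn_boolPair]
  have h := PolyTimeComputable.comp_holds hM hin
  exact h

end PolyTime

end OracleAlg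

end Literature.Computability.Complexity
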